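import Summits.QuantumFields.YangMills.Theorems.BalabanUVNodesN20WildMassLetterOfPersistentHistoryCount
import Summits.QuantumFields.YangMills.Theorems.BalabanUVNodesN19TameTiltLetterOfKPMarginRegimeFree
import Summits.QuantumFields.YangMills.Theorems.BalabanUVNodesN20HellingerLetterOfSlotPricesAndKPMargins
import Summits.QuantumFields.YangMills.Theorems.BalabanUVNodesN20HellingerRoadCapstone

/-!
# BalabanUVNodes ∕ node N20 (NE7b) — THE REGIME-FREE, ONE-MARGIN EDITION OF THE (H) LETTER FROM SINGLE-SLOT PRICES:
# (V‑a) ⟸ two single-slot dominations of the keyed polymer gas, (KR)+(V‑b) ⟸ ONE run's KP margin — no tame regime, no second margin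

Cell `pub-ymgap` (HUMAN RULING D-0062 Track A ∕ director-ym R399 (3a) width seats), WIDTH SEAT `pub-ymgap-dag-n20-w4` (node n20 = NE7b), generation g6,
CLAIM-1 ∕ INTENT-1 (bus I.36332, 2026-08-28T10:52Z; trigger: dag-n19-w4 g8's words I.36200 ∕ I.36316 «a successor edition feeding §2 instead drops
`hKPb ∕ h𝔄B ∕ K₀ ∕ hreg` from YOUR letter list too; yours to cut or leave»).  Route `Summits/QuantumFields/YangMills/Theses/BalabanUVNodes.lean`, key item K3⁸
`SpineGivenEndpointR13SepCoPHV` (stmt-QuantumFields-27366; skeleton of record v6 b4e55110ab73e679, stub 2 `stub_expansion13HV`, faces N20 `KeyedRelWeight` ∕ N19′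
core edge — this file is datum-free and version-free); filed `--kind proof --supports … --as helper`.  COUNT-NEUTRAL.  THEOREMS ONLY (0 `def`, 0 `instance`,
0 `notation`, 0 `sorry`).  ADDITIVE — imports this seat's g3 files p621499 `…N20WildMassLetterOfPersistentHistoryCount` (FILE 1: `wildMassLetter_of_slotDom_twoRate_log`,
`wildMassLetter_of_records_log`) and p623082 `…N20HellingerLetterOfSlotPricesAndKPMargins` (only its A6 lemma `slotDom_of_bad_eq_empty`, for §3), dag-n19-w4 g8's
`…N19TameTiltLetterOfKPMarginRegimeFree` (`affinityDefectLetter_of_kpMargin`) and dag-n20-w5 g4's capstone `…N20HellingerRoadCapstone` (p623765: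
`exists_hybridNE7_of_affinityDefectLetter_and_response`, for §4) BY NAME; modifies nothing, re-declares nothing.  p623082 stays as it is (its §1∕§2 keep
the four extra binders; consumers choose the edition).

WHAT.  p623082 composed the (V‑a) supplier of FILE 1 (two `T4HistoryPeeling.SlotDom`s on the keyed-gas carrier at the log two-rate budget, exponent 2) with
dag-n19-w4 g6's `…N19TameTiltLetterOfKPMargin.affinityDefectLetter_of_kpMargins` (p620730 §6), whose (KR)+(V‑b) side asked, per `(K,t)`, a weighted one-run KP
margin for EACH run on the tame sub-gas `Λ K ∖ O K t`, ONE size bound `𝔄` for EACH run, and the TAME REGIME `1 − 𝒜_tame ≤ 1∕16` from a threshold `K₀` on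
(the bootstrap of the edition-4 one-`(K,t)` letter).  dag-n19-w4 g8 LOCATED that the regime and the second tilt branch are IDLE (I.36200: the road's own radius
letter `Σ 1∕r_K < ∞` forces `r_K ≥ 2` eventually, a tilt branch on `closedBall 0 r` with `r ≥ 2` gives the `s`-UNIFORM variance letter on `[0,1]` directly —
dag-n19-w4 g5 p616152 `uniformVar_le_of_sup_bound_on_segment` + this seat's g2 p612607 `one_sub_affinity_le_var_div_eight` — hence NO bootstrap) and landed
the regime-free K-summation `…N19TameHellingerLetterRegimeFree` and its ONE-margin plug `…N19TameTiltLetterOfKPMarginRegimeFree.affinityDefectLetter_of_kpMargin`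
(p620730 §6's binder list with `(h𝔄B) (hKPb) (K₀) (hreg)` deleted).  THIS FILE is the N20-side successor edition of p623082 through that plug:
* §1 ★★★ `affinityDefectLetter_of_slotDoms_and_kpMargin_regimeFree` — p623082 §1 with the FOUR binders `(h𝔄B) (hKPb) (K₀) (hreg)` DELETED (and `aszB` gone):
  (V‑a) ⟸ `SlotDom` for run A and run B on the keyed-gas carrier at the budget `Cs·V·ϱ^{K − jlog_C(K)+1}∕(1 − ϱ)`, `2 < C·(−log ϱ)`; (KR)+(V‑b) ⟸ ONE run's
  weighted KP margin on `Λ K ∖ O K t` at radius `r K` with the two-run increment `|log b − log a|` in the exponent, ONE bound `𝔄 ≥ Σ_{Λ K ∖ O} aszA`, radii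
  `Σ 1∕r_K < ∞` ⇒ the SAME (H) letter `∃ η ≥ 0, Σ_K √η_K < ∞, 1 − 𝒜_K(t) ≤ η_K`; ★ `hellingerRate_of_slotDoms_and_kpMargin_regimeFree` — its ρ-shape.
* §2 ★★ `affinityDefectLetter_of_records_and_kpMargin_regimeFree` — p623082 §2 (ONE LEVEL LOWER on the (V‑a) side: `T4PersistentHistoryCount.slotDom_of_records`'
  per-record PRICES for both runs through FILE 1's `wildMassLetter_of_records_log`) with the same four binders deleted.
* §4 ★★★ `exists_hybridNE7_of_slotDoms_kpMargin_and_response` — END TO END: dag-n20-w5 g4's capstone `exists_hybridNE7_of_affinityDefectLetter_and_response`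
  (p623765) fed with §1 ⇒ K3 stub 2's three hybrid faces `HybridNE7 … (fun _ _ => ∅) (fun _ => 0) shA shB Wsh δ` at the keyed-gas carrier from `SlotDom_A`,
  `SlotDom_B`, ONE KP margin, `𝔄`, radii, rate + the capstone's (R′)∕(R‑c)∕regularity letters verbatim — the `SlotDom` twin of p623765 §3, regime-free.
* §3 ★ `letter_on_emptyGas` — A6, CONTENTFUL JOINT SATISFIABILITY of §1's antecedent: §1 APPLIED END TO END on the empty gas (`Λ K = O K t = ∅`) with GENUINE
  witnesses for every letter — both `SlotDom`s by p623082's `slotDom_of_bad_eq_empty`, the KP margin and the size bound vacuous with `𝔄 := 0`, radii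
  `r_K := (K+1)²`, rate `ϱ := e^{−1}`, `C := 3` (`2 < 3·1`), `Cs = V := 0` — and the conclusion EXHIBITED (not assumed); ★ `toy_hybridNE7_emptyGas` — §4 on
  the same gas with the capstone's letters at `Z ≡ 1`, `A' = B' ≡ 0`, `R₁ ≡ 0`, `χ = 0`: `HybridNE7` INHABITED through the whole road.
After this file the END-TO-END one-run letter list of the hellinger road's V-side through the `SlotDom` supplier reads: `SlotDom_A ∧ SlotDom_B` (or per-record prices)
∧ `KP_A` ∧ `𝔄` ∧ radii ∧ `2 < C·(−log ϱ)` — the regime, `KP_B`, `𝔄_B` are GONE (dag-n20-w5's capstone p623765 takes any (H) supplier in the ∃-shape).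
DICTIONARY memo ↔ tree: as in FILE 1's header (`ϱ = Λ₀σ`, `Λ₀ = L⁴`, `σ = e^{η̄ − κ₁}`, `−log ϱ = κ₁ − η̄ − 4 log L`).
CREDIT.  Road + K-summation: idea-3 g10–g14; R2 ∕ re-prices: CRIT-1 g5∕g6; tame-tilt ∕ KP-margin side, keyed-gas carrier AND the regime-free location: dag-n19-w4
g5–g8; persistent-history kernel: cell `pub-balaban` (`T4HistoryPeeling`, `T4PersistentHistoryCount`, `T4GoodClassBudget`, `T4MatchingClosure`); the refresh-process
twin of the (V‑a) supplier and the capstone: dag-n20-w5 g4∕g5 (p621610 ∕ p622199 ∕ p623765; regime-free twin `…N20RefreshProcessRoadRegimeFree`).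

HONEST FRAMING.  [folklore] by-name composition on hypothesis SHAPES.  EVERY letter — the two `SlotDom`s ∕ the per-record prices (the single-slot CONTEXT-UNIFORM
insertion price = the cards' (KR) + «printed factors as upper bounds on relative keyed class weights», the unprinted heart of NE7b), the multiplicative keyed
structure, run A's KP margin with the two-run increment in the exponent ((V‑b) = (YG), two-run, UNPRINTED for d = 4), `𝔄`, the radii `Σ 1∕r_K < ∞`, the rate
condition `2 < C·(−log ϱ)` — is a HYPOTHESIS produced by nobody; what moves is FOUR binders OFF the list, nothing else; (V‑a)'s truth for Bałaban's densities is
idea-3 g13's paper READING of [Balaban1989LargeFieldII] (1.79)–(1.85), not asserted here; NO estimate of Bałaban's programme is proved; nothing of Bałaban's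
asserted or instantiated (no `Provisos₁₃SepCoPH` tuple — K0⁷ OPEN); NE7 ∕ NE7b ∕ NE7c NOT PRINTED as two-run statements for d = 4 and NOT proved; N19′ ∕ N20 ∕ N21
NOT discharged; K3⁸ ∕ K3⁷ OPEN, not claimed; no node count is moved and no summit statement is proved by this seat.  One finite four-torus programme at fixed ε —
NOT ℝ⁴, NOT infinite volume, NOT OS, NOT a mass gap, NOT the Clay problem (R4 closes the conditional finite-𝕋⁴ rung `BalabanLadder.UV` only).  0 `def`; 0 `sorry`;
standard axioms; no cite tags.
-/

noncomputable section

namespace Summit.QuantumFields.YangMills.BalabanUVNodes.N20HellingerLetterOfSlotPricesAndKPMarginRegimeFree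

open Finset
open Literature.Probability.LatticeModels (IsCompatible)
open Literature.MathematicalPhysics.QuantumFieldTheory.Balaban1983to89.T4HistoryPeeling (SwitchOff SlotDom)
open Literature.MathematicalPhysics.QuantumFieldTheory.Balaban1983to89.T4GoodClassBudget (jlogOf)
open Literature.MathematicalPhysics.QuantumFieldTheory.Balaban1983to89.T4PersistentHistoryCount (records)
open Summit.QuantumFields.YangMills.BalabanUVNodes.N19TameConditionedHellingerLetterAlongK (exists_summable_sqrt_rate)
open Summit.QuantumFields.YangMills.BalabanUVNodes.N19TameTiltLetterOfKPMarginRegimeFree (affinityDefectLetter_of_kpMargin)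
open Summit.QuantumFields.YangMills.BalabanUVNodes.N20WildMassLetterOfPersistentHistoryCount
  (wildMassLetter_of_slotDom_twoRate_log wildMassLetter_of_records_log)
open Summit.QuantumFields.YangMills.BalabanUVNodes.N20HellingerLetterOfSlotPricesAndKPMargins (slotDom_of_bad_eq_empty)
open Literature.MathematicalPhysics.QuantumFieldTheory.Balaban1983to89.T4MatchingAssembly (HybridNE7)
open Summit.QuantumFields.YangMills.BalabanUVNodes.N20HellingerRoadCapstone (exists_hybridNE7_of_affinityDefectLetter_and_response)

variable {P : Type*} [DecidableEq P] (inc : P → P → Prop) [DecidableRel inc]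

/-! ## §1 (V‑a) from two `SlotDom`s on the keyed gas + (KR)+(V‑b) from ONE KP margin ⇒ the (H) letter — no regime [folklore, by name] -/

section SlotPrices

/-- **★★★ THE (H) LETTER FROM SINGLE-SLOT PRICES AND ONE KP MARGIN, REGIME-FREE** — p623082's `affinityDefectLetter_of_slotDoms_and_kpMargins` with the four
binders `(h𝔄B) (hKPb) (K₀) (hreg)` DELETED: dag-n19-w4 g8's `affinityDefectLetter_of_kpMargin` with its wild-mass block `(wm, hwm, hwildA, hwildB, hws)` DISCHARGED
by FILE 1's `wildMassLetter_of_slotDom_twoRate_log` on the keyed-gas carrier.  Data per key `K` and source `|t| ≤ l₀`: polymers `Λ K`, over-aged polymers `O K t`,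
POSITIVE one-run activities `a K t`, `b K t` (class weights `∏_{γ∈X} a`, `∏_{γ∈X} b` on the compatible families `X ⊆ Λ K`; wild classes = families meeting
`O K t`).  (V‑a) SIDE: `SlotDom` for run A and for run B on that carrier with the wild families as bad class and the log two-rate budget
`Cs·V·ϱ^{K − jlog_C(K)+1}∕(1 − ϱ)`, `0 < ϱ < 1`, `Cs, V ≥ 0`, EXPONENT-2 rate `2 < C·(−log ϱ)`.  (KR)+(V‑b) SIDE (dag-n19-w4 g8 §2 verbatim): ONE KP-size function
`aszA` with `Σ_{Λ K ∖ O K t} aszA ≤ 𝔄`, ONE weighted one-run KP margin (run A) on `Λ K ∖ O K t` at radius `r K` with the increment `|log b − log a|` in the exponent,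
`Σ 1∕r K < ∞` — NO second margin, NO tame regime.  CONCLUSION: `∃ η ≥ 0` with `Σ_K √η_K < ∞` and `1 − 𝒜_K(t) ≤ η_K` for all `K`, `|t| ≤ l₀`.
HONEST: every letter is a HYPOTHESIS produced by nobody; (V‑b) = (YG) two-run, UNPRINTED for d = 4. [folklore] -/
theorem affinityDefectLetter_of_slotDoms_and_kpMargin_regimeFree [Std.Refl inc] [Std.Symm inc] {l₀ : ℝ}
    (Λ : ℕ → Finset P) (O : ℕ → ℝ → Finset P) (a b aszA : ℕ → ℝ → P → ℝ)
    (ha : ∀ K t, |t| ≤ l₀ → ∀ γ ∈ Λ K, 0 < a K t γ) (hb : ∀ K t, |t| ≤ l₀ → ∀ γ ∈ Λ K, 0 < b K t γ)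
    {Cs V ϱ C : ℝ} (hCs : 0 ≤ Cs) (hV : 0 ≤ V) (h0 : 0 < ϱ) (h1 : ϱ < 1) (hC : 2 < C * (-Real.log ϱ))
    (hDA : SlotDom l₀ (fun K => (Λ K).powerset.filter (fun X => IsCompatible inc X)) (fun K t X => ∏ γ ∈ X, a K t γ)
      (fun K t => ((Λ K).powerset.filter (fun X => IsCompatible inc X)).filter (fun X => ¬ Disjoint X (O K t)))
      (fun K => Cs * V * (ϱ ^ (K - jlogOf C K + 1) / (1 - ϱ))))
    (hDB : SlotDom l₀ (fun K => (Λ K).powerset.filter (fun X => IsCompatible inc X)) (fun K t X => ∏ γ ∈ X, b K t γ)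
      (fun K t => ((Λ K).powerset.filter (fun X => IsCompatible inc X)).filter (fun X => ¬ Disjoint X (O K t)))
      (fun K => Cs * V * (ϱ ^ (K - jlogOf C K + 1) / (1 - ϱ))))
    (r : ℕ → ℝ) (hr : ∀ K, 0 < r K) (hrs : Summable fun K => 1 / r K)
    {𝔄 : ℝ} (h𝔄 : 0 ≤ 𝔄)
    (h𝔄A : ∀ K t, |t| ≤ l₀ → ∑ γ ∈ Λ K \ O K t, aszA K t γ ≤ 𝔄)
    (hKPa : ∀ K t, |t| ≤ l₀ → ∀ γ ∈ Λ K \ O K t, ∑ γ' ∈ (Λ K \ O K t) with inc γ' γ,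
      a K t γ' * Real.exp (r K * |Real.log (b K t γ') - Real.log (a K t γ')|) * Real.exp (aszA K t γ') ≤ aszA K t γ) :
    ∃ η : ℕ → ℝ, (∀ K, 0 ≤ η K) ∧ Summable (fun K => Real.sqrt (η K)) ∧
      ∀ K t, |t| ≤ l₀ →
        1 - ∑ X ∈ (Λ K).powerset with IsCompatible inc X,
          Real.sqrt (((∏ γ ∈ X, a K t γ) / ∑ Y ∈ (Λ K).powerset with IsCompatible inc Y, ∏ γ ∈ Y, a K t γ)
            * ((∏ γ ∈ X, b K t γ) / ∑ Y ∈ (Λ K).powerset with IsCompatible inc Y, ∏ γ ∈ Y, b K t γ)) ≤ η K := by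
  -- class weights are non-negative on the compatible families (products of positive activities)
  have hXΛ : ∀ K, ∀ X ∈ (Λ K).powerset.filter (fun X => IsCompatible inc X), X ⊆ Λ K :=
    fun K X hX => Finset.mem_powerset.1 (Finset.mem_filter.1 hX).1
  have hA : ∀ K t, |t| ≤ l₀ → ∀ X ∈ (Λ K).powerset.filter (fun X => IsCompatible inc X), 0 ≤ ∏ γ ∈ X, a K t γ :=
    fun K t ht X hX => Finset.prod_nonneg fun γ hγ => (ha K t ht γ (hXΛ K X hX hγ)).le
  have hB : ∀ K t, |t| ≤ l₀ → ∀ X ∈ (Λ K).powerset.filter (fun X => IsCompatible inc X), 0 ≤ ∏ γ ∈ X, b K t γ :=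
    fun K t ht X hX => Finset.prod_nonneg fun γ hγ => (hb K t ht γ (hXΛ K X hX hγ)).le
  -- the (V‑a) block from the two single-slot dominations (FILE 1, exponent 2)
  obtain ⟨wm, hwm, hwA, hwB, hws⟩ := wildMassLetter_of_slotDom_twoRate_log hCs hV h0 h1 hC hA hB hDA hDB
  -- the (H) letter from dag-n19-w4 g8's regime-free one-margin plug with that block supplied
  exact affinityDefectLetter_of_kpMargin inc Λ O a b aszA ha hb wm hwm hwA hwB hws r hr hrs h𝔄 h𝔄A hKPa

/-- **★ THE SUMMABLE HELLINGER RATE FROM SINGLE-SLOT PRICES AND ONE KP MARGIN, REGIME-FREE** — the ρ-shape of §1's letter: `∃ ρ ≥ 0` summable with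
`√(1 − 𝒜_K(t)) ≤ ρ_K` for all `K`, `|t| ≤ l₀` (dag-n19-w4's `exists_summable_sqrt_rate` by name) — the input of the per-set-TV ∕ class-law roads (dag-n19-w2
p612301, this seat's g0 p609004 `exists_hybridNE7_of_target_of_classLawTV`, dag-n20-w5's endpoint road and capstone). [folklore] -/
theorem hellingerRate_of_slotDoms_and_kpMargin_regimeFree [Std.Refl inc] [Std.Symm inc] {l₀ : ℝ}
    (Λ : ℕ → Finset P) (O : ℕ → ℝ → Finset P) (a b aszA : ℕ → ℝ → P → ℝ)
    (ha : ∀ K t, |t| ≤ l₀ → ∀ γ ∈ Λ K, 0 < a K t γ) (hb : ∀ K t, |t| ≤ l₀ → ∀ γ ∈ Λ K, 0 < b K t γ)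
    {Cs V ϱ C : ℝ} (hCs : 0 ≤ Cs) (hV : 0 ≤ V) (h0 : 0 < ϱ) (h1 : ϱ < 1) (hC : 2 < C * (-Real.log ϱ))
    (hDA : SlotDom l₀ (fun K => (Λ K).powerset.filter (fun X => IsCompatible inc X)) (fun K t X => ∏ γ ∈ X, a K t γ)
      (fun K t => ((Λ K).powerset.filter (fun X => IsCompatible inc X)).filter (fun X => ¬ Disjoint X (O K t)))
      (fun K => Cs * V * (ϱ ^ (K - jlogOf C K + 1) / (1 - ϱ))))
    (hDB : SlotDom l₀ (fun K => (Λ K).powerset.filter (fun X => IsCompatible inc X)) (fun K t X => ∏ γ ∈ X, b K t γ)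
      (fun K t => ((Λ K).powerset.filter (fun X => IsCompatible inc X)).filter (fun X => ¬ Disjoint X (O K t)))
      (fun K => Cs * V * (ϱ ^ (K - jlogOf C K + 1) / (1 - ϱ))))
    (r : ℕ → ℝ) (hr : ∀ K, 0 < r K) (hrs : Summable fun K => 1 / r K)
    {𝔄 : ℝ} (h𝔄 : 0 ≤ 𝔄)
    (h𝔄A : ∀ K t, |t| ≤ l₀ → ∑ γ ∈ Λ K \ O K t, aszA K t γ ≤ 𝔄)
    (hKPa : ∀ K t, |t| ≤ l₀ → ∀ γ ∈ Λ K \ O K t, ∑ γ' ∈ (Λ K \ O K t) with inc γ' γ,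
      a K t γ' * Real.exp (r K * |Real.log (b K t γ') - Real.log (a K t γ')|) * Real.exp (aszA K t γ') ≤ aszA K t γ) :
    ∃ ρ : ℕ → ℝ, Summable ρ ∧ (∀ K, 0 ≤ ρ K) ∧ ∀ K t, |t| ≤ l₀ →
      Real.sqrt (1 - ∑ X ∈ (Λ K).powerset with IsCompatible inc X,
          Real.sqrt (((∏ γ ∈ X, a K t γ) / ∑ Y ∈ (Λ K).powerset with IsCompatible inc Y, ∏ γ ∈ Y, a K t γ)
            * ((∏ γ ∈ X, b K t γ) / ∑ Y ∈ (Λ K).powerset with IsCompatible inc Y, ∏ γ ∈ Y, b K t γ))) ≤ ρ K := by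
  obtain ⟨η, _, hηs, hη⟩ := affinityDefectLetter_of_slotDoms_and_kpMargin_regimeFree inc Λ O a b aszA ha hb hCs hV h0 h1 hC hDA hDB
    r hr hrs h𝔄 h𝔄A hKPa
  exact exists_summable_sqrt_rate (x := fun K t => 1 - ∑ X ∈ (Λ K).powerset with IsCompatible inc X,
          Real.sqrt (((∏ γ ∈ X, a K t γ) / ∑ Y ∈ (Λ K).powerset with IsCompatible inc Y, ∏ γ ∈ Y, a K t γ)
            * ((∏ γ ∈ X, b K t γ) / ∑ Y ∈ (Λ K).powerset with IsCompatible inc Y, ∏ γ ∈ Y, b K t γ))) hηs hη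

end SlotPrices

/-! ## §2 One level lower on the (V‑a) side: per-record PRICES for both runs + ONE KP margin ⇒ the (H) letter — no regime [folklore, by name] -/

section RecordPrices

variable {γc ε : Type*} [DecidableEq γc] [DecidableEq ε]

/-- **★★ THE (H) LETTER FROM PER-RECORD PRICES AND ONE KP MARGIN, REGIME-FREE** — p623082's `affinityDefectLetter_of_records_and_kpMargins` with the four
binders `(h𝔄B) (hKPb) (K₀) (hreg)` DELETED: §1 with the two `SlotDom`s replaced by their construction from `T4PersistentHistoryCount.slotDom_of_records`
(FILE 1's `wildMassLetter_of_records_log`): for EACH run, per `(K,t)` a switch-off structure on the compatible families of `Λ K` whose bad class IS the set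
of families meeting `O K t`, slots injectively labelled by (birth step `< jlog_C(K)`, birth cell ∈ `Cell K (K − birth)`, `#Cell K a ≤ V·Λ₀^a`), per-record
prices `y ≤ ρ b·e^{−κ₁ W b}·Π_{e∈Q}(e^{−κ₁ W e}·η e)` over the records of the event universe `E K j` (events at steps in `(j, K]`, windows `W`, birth residuals
`Σ_b ρ b ≤ ρ̄`, event residuals `≤ η̄` per step) and the single-slot ratio bound with ratio `Σ_b Σ_Q y`; rate `0 < Λ₀·e^{η̄−κ₁} < 1` with EXPONENT 2
`2 < C·(−log(Λ₀·e^{η̄−κ₁}))`; plus §1's ONE-margin letters ⇒ `∃ η ≥ 0`, `Σ√η_K < ∞`, `1 − 𝒜_K(t) ≤ η_K`.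
HONEST: the per-record price (uniform in the context) is the unprinted single-slot insertion estimate — a HYPOTHESIS produced by nobody. [folklore] -/
theorem affinityDefectLetter_of_records_and_kpMargin_regimeFree [Std.Refl inc] [Std.Symm inc] {l₀ : ℝ}
    (Λ : ℕ → Finset P) (O : ℕ → ℝ → Finset P) (a b aszA : ℕ → ℝ → P → ℝ)
    (ha : ∀ K t, |t| ≤ l₀ → ∀ γ ∈ Λ K, 0 < a K t γ) (hb : ∀ K t, |t| ≤ l₀ → ∀ γ ∈ Λ K, 0 < b K t γ)
    (Cell : ℕ → ℕ → Finset γc) {V Λ₀ : ℝ} (hV : 0 ≤ V) (hΛ₀ : 0 ≤ Λ₀)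
    (hcell : ∀ K n, ((Cell K n).card : ℝ) ≤ V * Λ₀ ^ n) (Wd : ε → ℕ) (step : ε → ℕ)
    (E Bi : ℕ → ℕ → Finset ε) (hE : ∀ K j, ∀ e ∈ E K j, step e ∈ Ioc j K) {κ₁ ρbar ηbar C : ℝ} (hκ : 0 ≤ κ₁)
    (ρ : ε → ℝ) (hρ : ∀ K j, ∀ b' ∈ Bi K j, 0 ≤ ρ b') (hρbar : ∀ K j, ∑ b' ∈ Bi K j, ρ b' ≤ ρbar) (hρbar0 : 0 ≤ ρbar)
    (η : ε → ℝ) (hη : ∀ K j, ∀ e ∈ E K j, 0 ≤ η e)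
    (hηbar : ∀ K j, ∀ s ∈ Ioc j K, ∑ e ∈ E K j with step e = s, η e ≤ ηbar)
    (hr0 : 0 < Λ₀ * Real.exp (ηbar - κ₁)) (hr1 : Λ₀ * Real.exp (ηbar - κ₁) < 1)
    (hC : 2 < C * (-Real.log (Λ₀ * Real.exp (ηbar - κ₁))))
    (hdomA : ∀ K t, |t| ≤ l₀ → ∃ (n : ℕ) (Φ : SwitchOff ((Λ K).powerset.filter (fun X => IsCompatible inc X)) n)
        (birth : Fin n → ℕ) (cell : Fin n → γc) (y : Fin n → ε → Finset ε → ℝ),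
      ((Λ K).powerset.filter (fun X => IsCompatible inc X)).filter (fun X => ¬ Disjoint X (O K t)) = Φ.bad ∧
      (∀ i, birth i < jlogOf C K) ∧ (∀ i, cell i ∈ Cell K (K - birth i)) ∧
      Function.Injective (fun i => (⟨birth i, cell i⟩ : Σ _ : ℕ, γc)) ∧
      (∀ i, ∀ b' ∈ Bi K (birth i), ∀ Q ∈ records Wd (birth i) K (E K (birth i)) b', 0 ≤ y i b' Q) ∧
      (∀ i, ∀ b' ∈ Bi K (birth i), ∀ Q ∈ records Wd (birth i) K (E K (birth i)) b',
        y i b' Q ≤ ρ b' * Real.exp (-(κ₁ * Wd b')) * ∏ e ∈ Q, (Real.exp (-(κ₁ * Wd e)) * η e)) ∧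
      ∀ i : Fin n, ∀ τ'' ∈ (Λ K).powerset.filter (fun X => IsCompatible inc X), Φ.pend i τ'' = false →
        ∑ τ ∈ ((Λ K).powerset.filter (fun X => IsCompatible inc X)) with (Φ.pend i τ = true ∧ Φ.off i τ = τ''), ∏ γ ∈ τ, a K t γ
          ≤ (∑ b' ∈ Bi K (birth i), ∑ Q ∈ records Wd (birth i) K (E K (birth i)) b', y i b' Q) * ∏ γ ∈ τ'', a K t γ)
    (hdomB : ∀ K t, |t| ≤ l₀ → ∃ (n : ℕ) (Φ : SwitchOff ((Λ K).powerset.filter (fun X => IsCompatible inc X)) n)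
        (birth : Fin n → ℕ) (cell : Fin n → γc) (y : Fin n → ε → Finset ε → ℝ),
      ((Λ K).powerset.filter (fun X => IsCompatible inc X)).filter (fun X => ¬ Disjoint X (O K t)) = Φ.bad ∧
      (∀ i, birth i < jlogOf C K) ∧ (∀ i, cell i ∈ Cell K (K - birth i)) ∧
      Function.Injective (fun i => (⟨birth i, cell i⟩ : Σ _ : ℕ, γc)) ∧
      (∀ i, ∀ b' ∈ Bi K (birth i), ∀ Q ∈ records Wd (birth i) K (E K (birth i)) b', 0 ≤ y i b' Q) ∧
      (∀ i, ∀ b' ∈ Bi K (birth i), ∀ Q ∈ records Wd (birth i) K (E K (birth i)) b',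
        y i b' Q ≤ ρ b' * Real.exp (-(κ₁ * Wd b')) * ∏ e ∈ Q, (Real.exp (-(κ₁ * Wd e)) * η e)) ∧
      ∀ i : Fin n, ∀ τ'' ∈ (Λ K).powerset.filter (fun X => IsCompatible inc X), Φ.pend i τ'' = false →
        ∑ τ ∈ ((Λ K).powerset.filter (fun X => IsCompatible inc X)) with (Φ.pend i τ = true ∧ Φ.off i τ = τ''), ∏ γ ∈ τ, b K t γ
          ≤ (∑ b' ∈ Bi K (birth i), ∑ Q ∈ records Wd (birth i) K (E K (birth i)) b', y i b' Q) * ∏ γ ∈ τ'', b K t γ)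
    (r : ℕ → ℝ) (hr : ∀ K, 0 < r K) (hrs : Summable fun K => 1 / r K)
    {𝔄 : ℝ} (h𝔄 : 0 ≤ 𝔄)
    (h𝔄A : ∀ K t, |t| ≤ l₀ → ∑ γ ∈ Λ K \ O K t, aszA K t γ ≤ 𝔄)
    (hKPa : ∀ K t, |t| ≤ l₀ → ∀ γ ∈ Λ K \ O K t, ∑ γ' ∈ (Λ K \ O K t) with inc γ' γ,
      a K t γ' * Real.exp (r K * |Real.log (b K t γ') - Real.log (a K t γ')|) * Real.exp (aszA K t γ') ≤ aszA K t γ) :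
    ∃ η' : ℕ → ℝ, (∀ K, 0 ≤ η' K) ∧ Summable (fun K => Real.sqrt (η' K)) ∧
      ∀ K t, |t| ≤ l₀ →
        1 - ∑ X ∈ (Λ K).powerset with IsCompatible inc X,
          Real.sqrt (((∏ γ ∈ X, a K t γ) / ∑ Y ∈ (Λ K).powerset with IsCompatible inc Y, ∏ γ ∈ Y, a K t γ)
            * ((∏ γ ∈ X, b K t γ) / ∑ Y ∈ (Λ K).powerset with IsCompatible inc Y, ∏ γ ∈ Y, b K t γ)) ≤ η' K := by
  have hXΛ : ∀ K, ∀ X ∈ (Λ K).powerset.filter (fun X => IsCompatible inc X), X ⊆ Λ K :=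
    fun K X hX => Finset.mem_powerset.1 (Finset.mem_filter.1 hX).1
  have hA : ∀ K t, |t| ≤ l₀ → ∀ X ∈ (Λ K).powerset.filter (fun X => IsCompatible inc X), 0 ≤ ∏ γ ∈ X, a K t γ :=
    fun K t ht X hX => Finset.prod_nonneg fun γ hγ => (ha K t ht γ (hXΛ K X hX hγ)).le
  have hB : ∀ K t, |t| ≤ l₀ → ∀ X ∈ (Λ K).powerset.filter (fun X => IsCompatible inc X), 0 ≤ ∏ γ ∈ X, b K t γ :=
    fun K t ht X hX => Finset.prod_nonneg fun γ hγ => (hb K t ht γ (hXΛ K X hX hγ)).le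
  obtain ⟨wm, hwm, hwA, hwB, hws⟩ := wildMassLetter_of_records_log
    (T := fun K => (Λ K).powerset.filter (fun X => IsCompatible inc X))
    (A := fun K t X => ∏ γ ∈ X, a K t γ) (B := fun K t X => ∏ γ ∈ X, b K t γ)
    (Bad := fun K t => ((Λ K).powerset.filter (fun X => IsCompatible inc X)).filter (fun X => ¬ Disjoint X (O K t)))
    Cell hV hΛ₀ hcell Wd step E Bi hE hκ ρ hρ hρbar hρbar0 η hη hηbar hr0 hr1 hC hA hB hdomA hdomB
  exact affinityDefectLetter_of_kpMargin inc Λ O a b aszA ha hb wm hwm hwA hwB hws r hr hrs h𝔄 h𝔄A hKPa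

end RecordPrices

/-! ## §3 A6 — contentful joint satisfiability: §1 applied end to end on the empty gas [folklore] -/

section Toy

/-- **★ §1 ON THE EMPTY GAS — EVERY LETTER DISCHARGED BY A GENUINE WITNESS, THE CONCLUSION EXHIBITED** (A6, source-free non-vacuity of §1's antecedent as a
WHOLE, for any polymer type and incompatibility relation): with NO polymers (`Λ K = ∅`, `O K t = ∅`, activities `a = b = 1`) both `SlotDom`s hold by
p623082's `slotDom_of_bad_eq_empty` (the wild class is empty, the budget `0·0·ϱ^{…}∕(1 − ϱ) = 0` is non-negative), run A's KP margin and the size bound are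
vacuous with `aszA := 0`, `𝔄 := 0`, the radii `r_K := (K+1)²` have `Σ 1∕r_K < ∞`, and the rate letter holds at `ϱ := e^{−1}`, `C := 3` (`−log ϱ = 1`,
`2 < 3`); §1 then RETURNS its (H) letter for the one-class laws (which a reader may check reads `1 − √(1·1) = 0 ≤ η_K`).  Nothing of Bałaban's here — a
bookkeeping check that the binder list of §1 is jointly inhabited. [folklore] -/
theorem letter_on_emptyGas [Std.Refl inc] [Std.Symm inc] (l₀ : ℝ) :
    ∃ η : ℕ → ℝ, (∀ K, 0 ≤ η K) ∧ Summable (fun K => Real.sqrt (η K)) ∧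
      ∀ K t, |t| ≤ l₀ →
        1 - ∑ X ∈ ((fun _ : ℕ => (∅ : Finset P)) K).powerset with IsCompatible inc X,
          Real.sqrt (((∏ γ ∈ X, (fun (_ : ℕ) (_ : ℝ) (_ : P) => (1 : ℝ)) K t γ)
                / ∑ Y ∈ ((fun _ : ℕ => (∅ : Finset P)) K).powerset with IsCompatible inc Y, ∏ γ ∈ Y, (fun (_ : ℕ) (_ : ℝ) (_ : P) => (1 : ℝ)) K t γ)
            * ((∏ γ ∈ X, (fun (_ : ℕ) (_ : ℝ) (_ : P) => (1 : ℝ)) K t γ)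
                / ∑ Y ∈ ((fun _ : ℕ => (∅ : Finset P)) K).powerset with IsCompatible inc Y, ∏ γ ∈ Y, (fun (_ : ℕ) (_ : ℝ) (_ : P) => (1 : ℝ)) K t γ))
          ≤ η K := by
  -- the rate letter at `ϱ := e^{−1}`, `C := 3`
  have h0 : 0 < Real.exp (-1) := Real.exp_pos _
  have h1 : Real.exp (-1) < 1 := Real.exp_lt_one_iff.2 (by norm_num)
  have hC : (2 : ℝ) < 3 * (-Real.log (Real.exp (-1))) := by rw [Real.log_exp]; norm_num
  -- the radii `r_K := (K+1)²`
  have hr : ∀ K : ℕ, 0 < ((K : ℝ) + 1) ^ 2 := fun K => by positivity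
  have hrs : Summable fun K : ℕ => 1 / ((K : ℝ) + 1) ^ 2 := by
    have h := (summable_nat_add_iff (f := fun n : ℕ => 1 / (n : ℝ) ^ 2) 1).2
      (Real.summable_one_div_nat_pow.2 one_lt_two)
    simpa [Nat.cast_add, Nat.cast_one] using h
  -- both `SlotDom`s on the empty wild class at the (zero) budget
  have hBad : ∀ (K : ℕ) (t : ℝ), |t| ≤ l₀ →
      (((fun _ : ℕ => (∅ : Finset P)) K).powerset.filter (fun X => IsCompatible inc X)).filter
        (fun X => ¬ Disjoint X ((fun (_ : ℕ) (_ : ℝ) => (∅ : Finset P)) K t)) = ∅ := by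
    intro K t _
    exact Finset.filter_eq_empty_iff.2 fun X _ => by simp
  have hS : ∀ K : ℕ, (0 : ℝ) ≤ 0 * 0 * (Real.exp (-1) ^ (K - jlogOf 3 K + 1) / (1 - Real.exp (-1))) := fun K => by simp
  refine affinityDefectLetter_of_slotDoms_and_kpMargin_regimeFree inc (fun _ => (∅ : Finset P)) (fun _ _ => (∅ : Finset P))
    (fun _ _ _ => (1 : ℝ)) (fun _ _ _ => (1 : ℝ)) (fun _ _ _ => (0 : ℝ)) (by simp) (by simp)
    (Cs := 0) (V := 0) le_rfl le_rfl h0 h1 hC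
    (slotDom_of_bad_eq_empty hBad hS) (slotDom_of_bad_eq_empty hBad hS)
    (fun K => ((K : ℝ) + 1) ^ 2) hr hrs (𝔄 := 0) le_rfl (by simp) (by simp)

end Toy

/-! ## §4 END TO END through the `SlotDom` supplier: `HybridNE7` at the keyed-gas carrier from single-slot prices, ONE KP margin and the endpoint response [by name] -/

section Capstone

/-- **★★★ `HybridNE7` FROM SINGLE-SLOT PRICES, ONE KP MARGIN AND THE ENDPOINT RESPONSE — REGIME-FREE, NO HEAD CONDITION** [folklore + by-name transfer]:
dag-n20-w5 g4's capstone `exists_hybridNE7_of_affinityDefectLetter_and_response` (p623765: any (H) supplier in the ∃-shape + (R′) + (R‑c) ⇒ K3 stub 2's three hybrid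
faces with NO bad class and budget `0`) fed with §1 — so the V-side one-run letters are EXACTLY: `SlotDom_A`, `SlotDom_B` at the log two-rate budget with
`2 < C·(−log ϱ)` ((V‑a), single-slot prices), ONE weighted KP margin of run A on `Λ K ∖ O K t` at radius `r K` with ONE size bound `𝔄` ((KR)+(V‑b)), radii
`Σ 1∕r_K < ∞`; the capstone's own letters VERBATIM at the keyed-gas carrier (`T K :=` compatible families of `Λ K`, class weights `∏_{γ∈X} a K t γ`, `∏_{γ∈X} b K t γ`):
`0 ≤ l₀`, `0 < vol`, the E1∕E2 dictionary for `Z`, derivative carriers `A', B'` of the CLASS weights in the source on `|s| ≤ l₀`, (R′) `|E_{q_{K,s}}[B'∕B − A'∕A]| ≤ R₁ K`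
with `Σ R₁ < ∞`, (R‑c) the mixture second moment of run A's source current about a centring `m` bounded by `χ` (positivity of the class sums is DERIVED: the empty
family is a compatible class of weight `1`).  CONCLUSION: `∃ η Wsh shA shB` with the (H) letter for `η`, `Σ√η < ∞`, `0 ≤ Wsh K ≤ √(2η_K)`, `Wsh K < 1`, and
`HybridNE7 l₀ vol T A B (fun _ _ => ∅) (fun _ => 0) shA shB Wsh (K ↦ l₀·(R₁ K + 2√(2η_K)√χ)∕vol)`.  «Same socket, different suppliers» as p623765 §3 (refresh
processes + tame tilts, with regime): this is the `SlotDom` road, regime-free.  HONEST: every letter a HYPOTHESIS produced by nobody; NOT a discharge of N20. -/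
theorem exists_hybridNE7_of_slotDoms_kpMargin_and_response [Std.Refl inc] [Std.Symm inc] {l₀ vol : ℝ} (hl₀ : 0 ≤ l₀) (hvol : 0 < vol)
    (Λ : ℕ → Finset P) (O : ℕ → ℝ → Finset P) (a b aszA : ℕ → ℝ → P → ℝ)
    (ha : ∀ K t, |t| ≤ l₀ → ∀ γ ∈ Λ K, 0 < a K t γ) (hb : ∀ K t, |t| ≤ l₀ → ∀ γ ∈ Λ K, 0 < b K t γ)
    {Cs V ϱ C : ℝ} (hCs : 0 ≤ Cs) (hV : 0 ≤ V) (h0 : 0 < ϱ) (h1 : ϱ < 1) (hC : 2 < C * (-Real.log ϱ))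
    (hDA : SlotDom l₀ (fun K => (Λ K).powerset.filter (fun X => IsCompatible inc X)) (fun K t X => ∏ γ ∈ X, a K t γ)
      (fun K t => ((Λ K).powerset.filter (fun X => IsCompatible inc X)).filter (fun X => ¬ Disjoint X (O K t)))
      (fun K => Cs * V * (ϱ ^ (K - jlogOf C K + 1) / (1 - ϱ))))
    (hDB : SlotDom l₀ (fun K => (Λ K).powerset.filter (fun X => IsCompatible inc X)) (fun K t X => ∏ γ ∈ X, b K t γ)
      (fun K t => ((Λ K).powerset.filter (fun X => IsCompatible inc X)).filter (fun X => ¬ Disjoint X (O K t)))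
      (fun K => Cs * V * (ϱ ^ (K - jlogOf C K + 1) / (1 - ϱ))))
    (r : ℕ → ℝ) (hr : ∀ K, 0 < r K) (hrs : Summable fun K => 1 / r K)
    {𝔄 : ℝ} (h𝔄 : 0 ≤ 𝔄)
    (h𝔄A : ∀ K t, |t| ≤ l₀ → ∑ γ ∈ Λ K \ O K t, aszA K t γ ≤ 𝔄)
    (hKPa : ∀ K t, |t| ≤ l₀ → ∀ γ ∈ Λ K \ O K t, ∑ γ' ∈ (Λ K \ O K t) with inc γ' γ,
      a K t γ' * Real.exp (r K * |Real.log (b K t γ') - Real.log (a K t γ')|) * Real.exp (aszA K t γ') ≤ aszA K t γ)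
    -- the capstone's dictionary ∕ regularity ∕ R-side letters at the keyed-gas carrier, verbatim
    {Z : ℕ → ℝ → ℝ}
    (hZA' : ∀ (K : ℕ) (t : ℝ), |t| ≤ l₀ → Z K t = ∑ X ∈ (Λ K).powerset with IsCompatible inc X, ∏ γ ∈ X, a K t γ)
    (hZB' : ∀ (K : ℕ) (t : ℝ), |t| ≤ l₀ → Z (K + 1) t = ∑ X ∈ (Λ K).powerset with IsCompatible inc X, ∏ γ ∈ X, b K t γ)
    {A' B' : ℕ → ℝ → Finset P → ℝ}
    (hdA : ∀ (K : ℕ) (s : ℝ), |s| ≤ l₀ → ∀ X ∈ (Λ K).powerset.filter (fun X => IsCompatible inc X),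
      HasDerivAt (fun u => ∏ γ ∈ X, a K u γ) (A' K s X) s)
    (hdB : ∀ (K : ℕ) (s : ℝ), |s| ≤ l₀ → ∀ X ∈ (Λ K).powerset.filter (fun X => IsCompatible inc X),
      HasDerivAt (fun u => ∏ γ ∈ X, b K u γ) (B' K s X) s)
    {R₁ : ℕ → ℝ} {χ : ℝ} {m : ℕ → ℝ → ℝ}
    (hR : ∀ (K : ℕ) (s : ℝ), |s| ≤ l₀ →
      |∑ X ∈ (Λ K).powerset with IsCompatible inc X,
          (∏ γ ∈ X, b K s γ) / (∑ Y ∈ (Λ K).powerset with IsCompatible inc Y, ∏ γ ∈ Y, b K s γ)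
            * (B' K s X / (∏ γ ∈ X, b K s γ) - A' K s X / ∏ γ ∈ X, a K s γ)| ≤ R₁ K)
    (hRs : Summable R₁)
    (hχ : ∀ (K : ℕ) (s : ℝ), |s| ≤ l₀ →
      ∑ X ∈ (Λ K).powerset with IsCompatible inc X,
        ((∏ γ ∈ X, a K s γ) / (∑ Y ∈ (Λ K).powerset with IsCompatible inc Y, ∏ γ ∈ Y, a K s γ)
          + (∏ γ ∈ X, b K s γ) / (∑ Y ∈ (Λ K).powerset with IsCompatible inc Y, ∏ γ ∈ Y, b K s γ)) / 2
          * (A' K s X / (∏ γ ∈ X, a K s γ) - m K s) ^ 2 ≤ χ) :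
    ∃ (η Wsh : ℕ → ℝ) (shA shB : ℕ → ℝ → Finset P → ℝ),
      (∀ (K : ℕ) (t : ℝ), |t| ≤ l₀ →
        1 - ∑ X ∈ (Λ K).powerset with IsCompatible inc X,
          Real.sqrt (((∏ γ ∈ X, a K t γ) / ∑ Y ∈ (Λ K).powerset with IsCompatible inc Y, ∏ γ ∈ Y, a K t γ)
            * ((∏ γ ∈ X, b K t γ) / ∑ Y ∈ (Λ K).powerset with IsCompatible inc Y, ∏ γ ∈ Y, b K t γ)) ≤ η K) ∧
      Summable (fun K => Real.sqrt (η K)) ∧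
      (∀ K, 0 ≤ Wsh K ∧ Wsh K ≤ Real.sqrt (2 * η K) ∧ Wsh K < 1) ∧
      HybridNE7 l₀ vol (fun K => (Λ K).powerset.filter (fun X => IsCompatible inc X))
        (fun K t X => ∏ γ ∈ X, a K t γ) (fun K t X => ∏ γ ∈ X, b K t γ) (fun _ _ => ∅) (fun _ => 0) shA shB Wsh
        (fun K => l₀ * (R₁ K + 2 * Real.sqrt (2 * η K) * Real.sqrt χ) / vol) := by
  have hXΛ : ∀ K, ∀ X ∈ (Λ K).powerset.filter (fun X => IsCompatible inc X), X ⊆ Λ K :=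
    fun K X hX => Finset.mem_powerset.1 (Finset.mem_filter.1 hX).1
  have hA : ∀ K t, |t| ≤ l₀ → ∀ X ∈ (Λ K).powerset.filter (fun X => IsCompatible inc X), 0 < ∏ γ ∈ X, a K t γ :=
    fun K t ht X hX => Finset.prod_pos fun γ hγ => ha K t ht γ (hXΛ K X hX hγ)
  have hB : ∀ K t, |t| ≤ l₀ → ∀ X ∈ (Λ K).powerset.filter (fun X => IsCompatible inc X), 0 < ∏ γ ∈ X, b K t γ :=
    fun K t ht X hX => Finset.prod_pos fun γ hγ => hb K t ht γ (hXΛ K X hX hγ)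
  -- the class sums are positive: the empty family is a compatible class (weight `1`)
  have h0T : ∀ K, (∅ : Finset P) ∈ (Λ K).powerset.filter (fun X => IsCompatible inc X) := fun K =>
    Finset.mem_filter.2 ⟨Finset.empty_mem_powerset _, Literature.Probability.LatticeModels.isCompatible_empty⟩
  have hZA : ∀ K t, |t| ≤ l₀ → 0 < ∑ X ∈ (Λ K).powerset with IsCompatible inc X, ∏ γ ∈ X, a K t γ :=
    fun K t ht => Finset.sum_pos (fun X hX => hA K t ht X hX) ⟨∅, h0T K⟩
  have hZB : ∀ K t, |t| ≤ l₀ → 0 < ∑ X ∈ (Λ K).powerset with IsCompatible inc X, ∏ γ ∈ X, b K t γ :=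
    fun K t ht => Finset.sum_pos (fun X hX => hB K t ht X hX) ⟨∅, h0T K⟩
  exact exists_hybridNE7_of_affinityDefectLetter_and_response
    (T := fun K => (Λ K).powerset.filter (fun X => IsCompatible inc X))
    (A := fun K t X => ∏ γ ∈ X, a K t γ) (B := fun K t X => ∏ γ ∈ X, b K t γ)
    hl₀ hvol hA hB hZA hZB hZA' hZB' hdA hdB
    (affinityDefectLetter_of_slotDoms_and_kpMargin_regimeFree inc Λ O a b aszA ha hb hCs hV h0 h1 hC hDA hDB r hr hrs h𝔄 h𝔄A hKPa)
    hR hRs hχ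

/-- **★ `HybridNE7` INHABITED THROUGH THE WHOLE `SlotDom` ROAD ON THE EMPTY GAS** (A6): §4 APPLIED on the one-class carrier (`Λ K = O K t = ∅`, activities `1`)
with §3's witnesses for §1's letters and the capstone's letters at `Z ≡ 1`, `A' = B' ≡ 0`, `R₁ ≡ 0`, `χ = 0`, `m ≡ 0`, `vol = 1` — the composition
p621499 → dag-n19-w4 g8 → p618979∕p619159 → p609004 → p623765 FIRES end to end and returns stub 2's hybrid binder shape.  Bookkeeping only. [folklore] -/
theorem toy_hybridNE7_emptyGas [Std.Refl inc] [Std.Symm inc] {l₀ : ℝ} (hl₀ : 0 ≤ l₀) :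
    ∃ (η Wsh : ℕ → ℝ) (shA shB : ℕ → ℝ → Finset P → ℝ),
      HybridNE7 l₀ 1 (fun _ => (∅ : Finset P).powerset.filter (fun X => IsCompatible inc X))
        (fun _ _ X => ∏ _γ ∈ X, (1 : ℝ)) (fun _ _ X => ∏ _γ ∈ X, (1 : ℝ)) (fun _ _ => ∅) (fun _ => 0) shA shB Wsh
        (fun K => l₀ * (0 + 2 * Real.sqrt (2 * η K) * Real.sqrt 0) / 1) := by
  have h0 : 0 < Real.exp (-1) := Real.exp_pos _
  have h1 : Real.exp (-1) < 1 := Real.exp_lt_one_iff.2 (by norm_num)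
  have hC : (2 : ℝ) < 3 * (-Real.log (Real.exp (-1))) := by rw [Real.log_exp]; norm_num
  have hr : ∀ K : ℕ, 0 < ((K : ℝ) + 1) ^ 2 := fun K => by positivity
  have hrs : Summable fun K : ℕ => 1 / ((K : ℝ) + 1) ^ 2 := by
    have h := (summable_nat_add_iff (f := fun n : ℕ => 1 / (n : ℝ) ^ 2) 1).2
      (Real.summable_one_div_nat_pow.2 one_lt_two)
    simpa [Nat.cast_add, Nat.cast_one] using h
  have hBad : ∀ (K : ℕ) (t : ℝ), |t| ≤ l₀ →
      (((fun _ : ℕ => (∅ : Finset P)) K).powerset.filter (fun X => IsCompatible inc X)).filter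
        (fun X => ¬ Disjoint X ((fun (_ : ℕ) (_ : ℝ) => (∅ : Finset P)) K t)) = ∅ := by
    intro K t _
    exact Finset.filter_eq_empty_iff.2 fun X _ => by simp
  have hS : ∀ K : ℕ, (0 : ℝ) ≤ 0 * 0 * (Real.exp (-1) ^ (K - jlogOf 3 K + 1) / (1 - Real.exp (-1))) := fun K => by simp
  -- the one-class carrier and the capstone's letters on it
  have hT : (∅ : Finset P).powerset.filter (fun X => IsCompatible inc X) = {∅} := by
    rw [Finset.powerset_empty, Finset.filter_singleton,
      if_pos (Literature.Probability.LatticeModels.isCompatible_empty (inc := inc))]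
  have hZ : ∀ (K : ℕ) (t : ℝ), |t| ≤ l₀ →
      (fun (_ : ℕ) (_ : ℝ) => (1 : ℝ)) K t = ∑ X ∈ ((fun _ : ℕ => (∅ : Finset P)) K).powerset with IsCompatible inc X,
        ∏ γ ∈ X, (fun (_ : ℕ) (_ : ℝ) (_ : P) => (1 : ℝ)) K t γ := by
    intro K t _; rw [hT]; simp
  have hZ1 : ∀ (K : ℕ) (t : ℝ), |t| ≤ l₀ →
      (fun (_ : ℕ) (_ : ℝ) => (1 : ℝ)) (K + 1) t = ∑ X ∈ ((fun _ : ℕ => (∅ : Finset P)) K).powerset with IsCompatible inc X,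
        ∏ γ ∈ X, (fun (_ : ℕ) (_ : ℝ) (_ : P) => (1 : ℝ)) K t γ := by
    intro K t _; rw [hT]; simp
  have hd : ∀ (K : ℕ) (s : ℝ), |s| ≤ l₀ → ∀ X ∈ ((fun _ : ℕ => (∅ : Finset P)) K).powerset.filter (fun X => IsCompatible inc X),
      HasDerivAt (fun u => ∏ γ ∈ X, (fun (_ : ℕ) (_ : ℝ) (_ : P) => (1 : ℝ)) K u γ) ((fun (_ : ℕ) (_ : ℝ) (_ : Finset P) => (0 : ℝ)) K s X) s :=
    fun K s _ X _ => hasDerivAt_const s _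
  obtain ⟨η, Wsh, shA, shB, -, -, -, hNE7⟩ := exists_hybridNE7_of_slotDoms_kpMargin_and_response inc hl₀ one_pos
    (fun _ => (∅ : Finset P)) (fun _ _ => (∅ : Finset P)) (fun _ _ _ => (1 : ℝ)) (fun _ _ _ => (1 : ℝ)) (fun _ _ _ => (0 : ℝ))
    (by simp) (by simp) (Cs := 0) (V := 0) le_rfl le_rfl h0 h1 hC
    (slotDom_of_bad_eq_empty hBad hS) (slotDom_of_bad_eq_empty hBad hS)
    (fun K => ((K : ℝ) + 1) ^ 2) hr hrs (𝔄 := 0) le_rfl (by simp) (by simp)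
    (Z := fun _ _ => (1 : ℝ)) hZ hZ1 (A' := fun _ _ _ => (0 : ℝ)) (B' := fun _ _ _ => (0 : ℝ)) hd hd
    (R₁ := fun _ => (0 : ℝ)) (χ := 0) (m := fun _ _ => (0 : ℝ)) (fun K s _ => by simp) summable_zero (fun K s _ => by simp)
  exact ⟨η, Wsh, shA, shB, hNE7⟩

end Capstone

end Summit.QuantumFields.YangMills.BalabanUVNodes.N20HellingerLetterOfSlotPricesAndKPMarginRegimeFree

end
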